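import Literature.NumberTheory.Sieve.PolynomialCongruencesPrimeModuli
import HarnessLib

/-!
# Duke–Friedlander–Iwaniec 1995: the architecture of the proof (named facts)

Topic `Literature/NumberTheory/Sieve`.  Second layer of the decomposition of the named fact
`Literature.NumberTheory.Sieve.dukeFriedlanderIwaniec1995_quadraticRoots_primeModuli`
(`PolynomialCongruencesPrimeModuli.lean`): for `f(X) = aX² + 2bX + c ∈ ℤ[X]` with
`D = ac − b² > 0` and every `h ≠ 0`, `∑_{p ≤ x} ρ_h(p) = o(π(x))`,
`ρ_h(n) = ∑_{f(ν) ≡ 0 (mod n)} e(hν/n)` (`= polyRootWeylSum f n h`)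
[cite: DukeFriedlanderIwaniec1995, Theorem p. 424 and (4), (6)].  The paper (W. Duke,
J. B. Friedlander, H. Iwaniec, Ann. of Math. 141 (1995) 423–441) proves it in three blocks,
vendored here AS PRINTED, as named facts:

* **the sieve for complex sequences** (§6, elementary): `dukeFriedlanderIwaniec1995_theorem5` — for complex `c_n`
  (`1 ≤ n ≤ x`) with `|c_n| ≤ τ(n)`, a level-`x^{1/2−ε}` bound (34) for the special bilinear
  forms `R(D) = ∑_{d<D} λ_d ∑_m c_{dm}` and a bound (35) for the general bilinear forms
  `R(w, y) = ∑_{w ≤ n < y} β_n ∑_{(m,n)=1} α_m c_{mn}` (`β` on primes, `|α_m| ≤ ω(m)`,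
  `y = x^{1/3−ε}`, `w = x^{(log log x)^{-3}}`) give `∑_{p ≤ x} c_p ≪ ε π(x)` for `x > x₀`
  [cite: DukeFriedlanderIwaniec1995, Theorem 5 p. 437, with (32)–(35)];
* **linear forms** (§4, spectral theory of Poincaré series on `Γ₀(q)`, Kuznetsov's formula,
  Weil's bound): `dukeFriedlanderIwaniec1995_proposition4` [cite: DukeFriedlanderIwaniec1995, Proposition 4 p. 432]
  and its un-smoothed consequence `dukeFriedlanderIwaniec1995_proposition1`:
  `L_d(M) = ∑_{M<m≤2M} ρ_h(dm) ≪ (h,d)^{1/20} (d/M)^{1/20} M^{1+ε}` for `d ≪ M`, `h ≪ dM`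
  [cite: DukeFriedlanderIwaniec1995, Proposition 1 p. 425, (9)];
* **bilinear forms** (§5, from (25) by Cauchy's inequality): `dukeFriedlanderIwaniec1995_proposition2`:
  `B(M, N) = ∑∑_{(m,n)=1} α_m β_n ρ_h(mn) ≪ ‖αρ‖ ‖β‖ (M^{1/2} + N^{3/4} M^{3/8+ε})` for `β`
  supported on primes and `h ≪ MN` [cite: DukeFriedlanderIwaniec1995, Proposition 2 p. 426, (10)].

§7 of the paper ("Conclusion", p. 438) is the assembly: Theorem 5 applied to `c_n = ρ_h(n)`,
hypothesis (34) following from Proposition 1 and (35) from Proposition 2, gives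
`∑_{p ≤ x} ρ_h(p) ≪ ε π(x)`, and `ε → 0` gives (6).  That assembly is carried out in Lean in the
companion file `QuadraticRootsPrimeModuliDFIAssembly.lean`; this file only fixes the objects
and the printed statements.  Nothing here is specific to negative discriminant except the
hypothesis `ac − b² > 0` of the three analytic facts; Tóth (IMRN 2000) proves the analogues of
Propositions 1–2 for positive discriminant and concludes by the same Theorem 5.

## Source and how it was read

The statements below were taken from the printed paper in the form of the author-hosted copy of
the journal version, `https://www.math.ucla.edu/~wdduke/preprints/equidistribution.pdf`
(W. Duke's homepage lists it under the dead link `equi.pdf`; acquisition requests acq-00058 =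
doi:10.2307/2118527 and acq-00842 = this URL; `lit read` of the URL materialises it as a
`paper:url-…` document).  That file is the JSTOR scan: its text layer carries the prose (section
and statement wording, numbering, page headers) but garbles displayed formulas, so every
displayed formula quoted here — (9), (10), the bound of Proposition 4, (25), (32)–(35), Theorem 5 —
was read off the page images themselves (pp. 424–426, 432–438, rendered from the scan's image
layer), not from OCR.  Independent corroboration in held sources: Proposition 1 is restated
verbatim (with `N = d`, `x = dM`) as [cite: Ngo2024, (1.2)]; Proposition 4 and Theorem 5 have
variants with explicit `h`-dependence in K. Homma, J. Number Theory 128 (2008), Theorem 1 (one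
fixed weight `g`, bound `x^{1/2} + d^{−1/2}(h,d)^{1/4} x^{3/4} τ(dh)² (log x)²`) and Lemma 1 (a
modification of the sieve with `(log x)^{−4}` in the bilinear hypothesis), cf. [cite: Homma2008,
Theorem 1 and Lemma 1] — these are NOT the forms vendored here and are cited only as cross-checks
of shape.

## Conventions (how the printed `≪`-statements are quantified)

* `h` is a positive integer (the paper reduces to `h > 0`, p. 424: `ρ_{−h} = conj ∘ ρ_h`).
* "Suppose `d ≪ M` and `h ≪ dM`. Then `L_d(M) ≪ …`, the implied constant depending on `ε` and
  `D`" is rendered: for all `C₁, C₂ > 0` there is `K` (depending on `a, b, c, ε, C₁, C₂`) such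
  that the bound holds with constant `K` whenever `d ≤ C₁ M`, `h ≤ C₂ d M`; likewise for
  Propositions 2 and 4.  Letting `K` depend on `(a, b, c)` rather than on `D` alone is weaker than
  printed.
* Smooth weights (Proposition 4): `G : ℝ → ℂ` of class `C⁴`, vanishing off `[N, 2N]`, with
  `|G^{(j)}| ≤ N^{−j}` for `0 ≤ j ≤ 4` (the printed `G^{(j)} ≪ N^{−j}`, normalised; by
  linearity this is no loss).
* Theorem 5: the sequence `c : ℕ → ℂ` is fixed and the hypotheses (34), (35) are required for
  all `x ≥ x₁` with implied constants `A₁, A₂`; the conclusion holds for `x ≥ x₀` where `x₀` may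
  depend on everything (`ε`, `c`, `x₁`, `A₁`, `A₂`) while the constant `C` in
  `|∑_{p ≤ x} c_p| ≤ C ε π(x)` is absolute — this is the reading under which §7 applies it (the
  constants furnished by Propositions 1, 2 depend on `ε`, `D`, `h`).  We also restrict to
  `0 < ε ≤ 1/12` (the statement is only of interest as `ε → 0`; a restriction of the printed
  range, hence implied by it).
* `τ(n) = #(Nat.divisors n)`, `ω(m) = ArithmeticFunction.cardDistinctFactors m`,
  `(h, d) = Nat.gcd h d`, `π = Nat.primeCounting`, real parameters `x, M, N, D ≥ 1`, integer
  ranges cut at `⌊·⌋₊`.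

## References

* W. Duke, J. B. Friedlander, H. Iwaniec, *Equidistribution of roots of a quadratic congruence to
  prime moduli*, Ann. of Math. (2) 141 (1995), 423–441: Theorem (p. 424), (8), Propositions 1–2
  (pp. 425–426), Proposition 4 and (25) (p. 432), §6 (26)–(36), Theorem 5 (p. 437), §7 (p. 438).
  [cite: DukeFriedlanderIwaniec1995, Propositions 1, 2, 4 and Theorem 5]
* K. Homma, *On the discrepancy of uniformly distributed roots of quadratic congruences*,
  J. Number Theory 128 (2008) 500–508, Theorem 1 and Lemma 1 (variants, with explicit
  `h`-dependence, of Proposition 4 and of the sieve theorem; cross-checks of shape only).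
  [cite: Homma2008, Theorem 1 and Lemma 1]
* H. T. Ngo, *On roots of quadratic congruences*, Bull. LMS 56 (2024), (1.2) (Proposition 1
  restated). [cite: Ngo2024, (1.2)]
-/

namespace Literature.NumberTheory.Sieve

open scoped BigOperators Polynomial
open Finset Polynomial

namespace DFI1995

/-! ### The objects -/

/-- DFI's quadratic `f(X) = aX² + 2bX + c` (the theorem assumes the "positive determinant"
`D = ac − b² > 0`, i.e. discriminant `(2b)² − 4ac = −4D < 0`).
[cite: DukeFriedlanderIwaniec1995, Theorem p. 424] -/
noncomputable def quad (a b c : ℤ) : ℤ[X] := C a * X ^ 2 + C (2 * b) * X + C c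

/-- `quad a b c` evaluates as `a x² + 2b x + c`. [folklore] -/
theorem eval_quad (a b c x : ℤ) : (quad a b c).eval x = a * x ^ 2 + 2 * b * x + c := by
  simp [quad]

/-- **The special linear form** `L_d(M) = ∑_{M < m ≤ 2M} ρ_h(dm)`
(`ρ_h(n) = polyRootWeylSum f n h`). [cite: DukeFriedlanderIwaniec1995, p. 425 (display before (8))] -/
noncomputable def linearForm (f : ℤ[X]) (h : ℤ) (d : ℕ) (M : ℝ) : ℂ :=
  ∑ m ∈ (Icc 1 ⌊2 * M⌋₊).filter (fun m : ℕ => M < (m : ℝ)), polyRootWeylSum f (d * m) h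

/-- **The general bilinear form** `B(M, N) = ∑∑_{(m,n)=1} α_m β_n ρ_h(mn)` over `1 ≤ m ≤ 2M`,
`1 ≤ n ≤ 2N` coprime; the printed support conditions `M < m ≤ 2M`, `N < n ≤ 2N` on the
coefficients are imposed where the form is used. [cite: DukeFriedlanderIwaniec1995, (8)] -/
noncomputable def bilinearForm (f : ℤ[X]) (h : ℤ) (α β : ℕ → ℂ) (M N : ℝ) : ℂ :=
  ∑ m ∈ Icc 1 ⌊2 * M⌋₊, ∑ n ∈ (Icc 1 ⌊2 * N⌋₊).filter (fun n : ℕ => Nat.Coprime m n),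
    α m * β n * polyRootWeylSum f (m * n) h

/-- The weighted norm `‖αρ‖ = (∑_{m ≤ 2M} |α_m|² ρ(m)²)^{1/2}` of Proposition 2
(`ρ(m) = ρ_0(m) = polyRootCountMod ![f] m`). [cite: DukeFriedlanderIwaniec1995, (10)] -/
noncomputable def normAlphaRho (f : ℤ[X]) (α : ℕ → ℂ) (M : ℝ) : ℝ :=
  Real.sqrt (∑ m ∈ Icc 1 ⌊2 * M⌋₊, ‖α m‖ ^ 2 * (polyRootCountMod ![f] m : ℝ) ^ 2)

/-- The `ℓ²`-norm `‖β‖ = (∑_{n ≤ 2N} |β_n|²)^{1/2}`. [folklore] -/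
noncomputable def l2Norm (β : ℕ → ℂ) (N : ℝ) : ℝ :=
  Real.sqrt (∑ n ∈ Icc 1 ⌊2 * N⌋₊, ‖β n‖ ^ 2)

/-- **`R(D)`**, the special bilinear forms of the sieve: `R(D) = ∑_{d < D} λ_d ∑_m c_{dm}` for a
sequence `c` supported on `1 ≤ n ≤ x` (so `m` runs over `dm ≤ x`).
[cite: DukeFriedlanderIwaniec1995, (32)] -/
noncomputable def sieveR₁ (c lam : ℕ → ℂ) (x D : ℝ) : ℂ :=
  ∑ d ∈ (Icc 1 ⌊x⌋₊).filter (fun d : ℕ => (d : ℝ) < D), lam d * ∑ m ∈ Icc 1 (⌊x⌋₊ / d), c (d * m)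

/-- **`R(w, y)`**, the general bilinear forms of the sieve:
`R(w, y) = ∑_{w ≤ n < y} β_n ∑_{(m,n)=1} α_m c_{mn}` for `c` supported on `1 ≤ n ≤ x`
(`m` runs over `mn ≤ x`). [cite: DukeFriedlanderIwaniec1995, (33)] -/
noncomputable def sieveR₂ (c α β : ℕ → ℂ) (x w y : ℝ) : ℂ :=
  ∑ n ∈ (Icc 1 ⌊x⌋₊).filter (fun n : ℕ => w ≤ (n : ℝ) ∧ (n : ℝ) < y),
    β n * ∑ m ∈ (Icc 1 (⌊x⌋₊ / n)).filter (fun m : ℕ => Nat.Coprime m n), α m * c (m * n)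

end DFI1995

/-! ### The three analytic inputs (spectral theory) -/

/-- **DFI Proposition 1 (linear forms).**  Let `f = aX² + 2bX + c ∈ ℤ[X]` with `D = ac − b² > 0`,
`h ≥ 1`.  Suppose `d ≪ M` and `h ≪ dM`.  Then
`L_d(M) = ∑_{M < m ≤ 2M} ρ_h(dm) ≪ (h, d)^{1/20} (d/M)^{1/20} M^{1+ε}`, the implied constant
depending on `ε` and `D` (here: on `ε`, `a, b, c` and the constants `C₁, C₂` in `d ≤ C₁M`,
`h ≤ C₂dM`).  Proved in §4 of the paper from Proposition 4 via (25) by un-smoothing.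
[cite: DukeFriedlanderIwaniec1995, Proposition 1 p. 425, (9)] -/
def dukeFriedlanderIwaniec1995_proposition1 : Prop :=
  ∀ a b c : ℤ, 0 < a * c - b ^ 2 → ∀ ε : ℝ, 0 < ε → ∀ C₁ C₂ : ℝ, 0 < C₁ → 0 < C₂ →
    ∃ K : ℝ, ∀ h : ℕ, 1 ≤ h → ∀ d : ℕ, 1 ≤ d → ∀ M : ℝ, 1 ≤ M →
      (d : ℝ) ≤ C₁ * M → (h : ℝ) ≤ C₂ * d * M →
      ‖DFI1995.linearForm (DFI1995.quad a b c) h d M‖ ≤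
        K * (Nat.gcd h d : ℝ) ^ (1 / 20 : ℝ) * ((d : ℝ) / M) ^ (1 / 20 : ℝ) * M ^ (1 + ε)

/-- **DFI Proposition 2 (bilinear forms).**  Let `f = aX² + 2bX + c ∈ ℤ[X]` with `D = ac − b² > 0`,
`h ≥ 1`, and let `α_m`, `β_n` be complex numbers supported in `M < m ≤ 2M`, `N < n ≤ 2N`, with
`β_n` supported on primes.  For `h ≪ MN`:
`B(M, N) = ∑∑_{(m,n)=1} α_m β_n ρ_h(mn) ≪ ‖αρ‖ ‖β‖ (M^{1/2} + N^{3/4} M^{3/8+ε})`,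
`‖αρ‖² = ∑ |α_m|² ρ(m)²`, `‖β‖² = ∑ |β_n|²`, the implied constant depending on `ε` and `D`
(here: on `ε`, `a, b, c` and the constant in `h ≤ C₂MN`).  Proved in §5 of the paper from (25).
[cite: DukeFriedlanderIwaniec1995, Proposition 2 p. 426, (10)] -/
def dukeFriedlanderIwaniec1995_proposition2 : Prop :=
  ∀ a b c : ℤ, 0 < a * c - b ^ 2 → ∀ ε : ℝ, 0 < ε → ∀ C₂ : ℝ, 0 < C₂ →
    ∃ K : ℝ, ∀ h : ℕ, 1 ≤ h → ∀ M N : ℝ, 1 ≤ M → 1 ≤ N → (h : ℝ) ≤ C₂ * M * N →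
      ∀ α β : ℕ → ℂ, (∀ m : ℕ, α m ≠ 0 → M < (m : ℝ) ∧ (m : ℝ) ≤ 2 * M) →
        (∀ n : ℕ, β n ≠ 0 → N < (n : ℝ) ∧ (n : ℝ) ≤ 2 * N ∧ n.Prime) →
        ‖DFI1995.bilinearForm (DFI1995.quad a b c) h α β M N‖ ≤
          K * DFI1995.normAlphaRho (DFI1995.quad a b c) α M * DFI1995.l2Norm β N *
            (M ^ (1 / 2 : ℝ) + N ^ (3 / 4 : ℝ) * M ^ (3 / 8 + ε))

/-- **DFI Proposition 4 (smoothed linear forms; the spectral input).**  Let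
`f = aX² + 2bX + c ∈ ℤ[X]` with `D = ac − b² > 0`, `h ≥ 1`, `d ≥ 1`.  Suppose `G` is supported on
`[N, 2N]` and has derivatives `G^{(j)} ≪ N^{−j}`, `0 ≤ j ≤ 4` (normalised here to
`|G^{(j)}| ≤ N^{−j}`), and let `h ≪ N`.  Then
`∑_{n ≡ 0 (d)} ρ_h(n) G(n) ≪ τ(d) N^{1/2} [1 + τ(hd) (h,d)^{1/2} d^{−1} N^{1/2}]^{1/2} log 2N`,
where the implied constant depends only on `D` (here: on `a, b, c` and the constant in
`h ≤ C₂N`).  This is the output of the spectral decomposition of the Poincaré series (14)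
(Proposition 3: spectral theorem on `Γ₀(q)∖ℍ`, Kuznetsov's formula, Weil's bound); a variant
with one fixed weight and explicit `h`-dependence is Homma 2008, Theorem 1 (cf. the module
docstring). [cite: DukeFriedlanderIwaniec1995, Proposition 4 p. 432] -/
def dukeFriedlanderIwaniec1995_proposition4 : Prop :=
  ∀ a b c : ℤ, 0 < a * c - b ^ 2 → ∀ C₂ : ℝ, 0 < C₂ →
    ∃ K : ℝ, ∀ h : ℕ, 1 ≤ h → ∀ d : ℕ, 1 ≤ d → ∀ N : ℝ, 1 ≤ N → (h : ℝ) ≤ C₂ * N →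
      ∀ G : ℝ → ℂ, ContDiff ℝ 4 G → (∀ t : ℝ, G t ≠ 0 → N ≤ t ∧ t ≤ 2 * N) →
        (∀ j : ℕ, j ≤ 4 → ∀ t : ℝ, ‖iteratedDeriv j G t‖ ≤ N ^ (-(j : ℝ))) →
        ‖∑ n ∈ (Icc 1 ⌊2 * N⌋₊).filter (fun n : ℕ => d ∣ n),
            polyRootWeylSum (DFI1995.quad a b c) n h * G n‖ ≤
          K * (Nat.divisors d).card * N ^ (1 / 2 : ℝ) *
            Real.sqrt (1 + (Nat.divisors (h * d)).card * (Nat.gcd h d : ℝ) ^ (1 / 2 : ℝ) / d *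
              N ^ (1 / 2 : ℝ)) * Real.log (2 * N)

/-! ### The sieve for complex sequences -/

/-- **DFI Theorem 5 (a sieve producing `∑_{p ≤ x} c_p ≪ ε π(x)` from bilinear-form
information).**  Let `C = {c_n}`, `1 ≤ n ≤ x`, be complex numbers bounded by `τ(n)` such that
(34) `R(D) ≪ x (log x)^{−2}` holds with `D = x^{1/2−ε}` — for all coefficients `|λ_d| ≤ 1`,
`R(D) = ∑_{d < D} λ_d ∑_m c_{dm}` — and (35) `R(w, y) ≪ x (log x)^{−10}` holds with
`y = x^{1/3−ε}`, `w = x^{(log log x)^{−3}}` — for all `|α_m| ≤ ω(m)`, `|β_n| ≤ 1`, `β_n`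
supported on primes, `R(w, y) = ∑_{w ≤ n < y} β_n ∑_{(m,n)=1} α_m c_{mn}`.  Then
`∑_{p ≤ x} c_p ≪ ε π(x)` provided `x > x₀(ε)`, the implied constant being absolute.
Quantifier reading (module docstring): `c` fixed, (34)–(35) for all `x ≥ x₁` with constants
`A₁, A₂`; `x₀` may depend on `ε, c, x₁, A₁, A₂`; `C` absolute; `0 < ε ≤ 1/12`.  The proof (§6:
Buchstab's identity twice, Legendre's identity, Lemmas 1–3) is elementary.  NB for users (§7):
`|c_n| ≤ τ(n)` is the exact inequality; it FAILS for `c_n = ρ_h(n)` itself (e.g. `f = X² + 64`,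
`ρ(64) = 8 > τ(64) = 7`), so the theorem is to be applied to `ρ_h/B_f` with `|ρ_h(n)| ≤ B_f τ(n)`
(fine, (34)–(35) and the conclusion being linear in `c`).
[cite: DukeFriedlanderIwaniec1995, Theorem 5 p. 437, with (32)–(35) and Lemmas 1–3] -/
def dukeFriedlanderIwaniec1995_theorem5 : Prop :=
  ∃ C : ℝ, ∀ ε : ℝ, 0 < ε → ε ≤ 1 / 12 → ∀ c : ℕ → ℂ,
    (∀ n : ℕ, 1 ≤ n → ‖c n‖ ≤ (Nat.divisors n).card) →
    ∀ x₁ A₁ A₂ : ℝ,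
      (∀ x : ℝ, x₁ ≤ x → ∀ lam : ℕ → ℂ, (∀ d : ℕ, ‖lam d‖ ≤ 1) →
          ‖DFI1995.sieveR₁ c lam x (x ^ (1 / 2 - ε))‖ ≤ A₁ * x / Real.log x ^ 2) →
      (∀ x : ℝ, x₁ ≤ x → ∀ α β : ℕ → ℂ,
          (∀ m : ℕ, ‖α m‖ ≤ ArithmeticFunction.cardDistinctFactors m) →
          (∀ n : ℕ, ‖β n‖ ≤ 1) → (∀ n : ℕ, ¬ n.Prime → β n = 0) →
          ‖DFI1995.sieveR₂ c α β x (x ^ ((Real.log (Real.log x))⁻¹ ^ 3)) (x ^ (1 / 3 - ε))‖ ≤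
            A₂ * x / Real.log x ^ 10) →
      ∃ x₀ : ℝ, ∀ x : ℝ, x₀ ≤ x →
        ‖∑ p ∈ Nat.primesLE ⌊x⌋₊, c p‖ ≤ C * ε * Nat.primeCounting ⌊x⌋₊

end Literature.NumberTheory.Sieve
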